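import Literature.Barriers.NavierStokesRegularity.FrozenShellShapeNoDephasing
import HarnessLib

/-!
# Barrier `FrozenShellShapeNoDephasing`, concrete witnesses on `𝕋³`: columnar single-shell data with
# arbitrarily many ALIGNED modes — no universal bound on the in-shell phase-alignment ratio along
# all Navier–Stokes solutions (the shape of C135's (51), for the canonical functional)

Support file (all results proved, standard axioms) of the barrier catalogue entry
`Literature.Barriers.NavierStokesRegularity.FrozenShellShapeNoDephasing`. The entry reduces every universal
in-shell relaxation law to a STATIC bound on cross-transversal trigonometric data; this file shows the
static bound FAILS for the stock functional `FrozenShellShape.alignRatio` over full lattice shells: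

* `gaussPoint j a = 5^{j−a}(p_a, q_a, 0)`, `p_a + i q_a = (3 + 4i)^a` (`a ≤ j`): `j + 1` distinct HORIZONTAL
  lattice points on the shell `|k|² = 25^j` (Gaussian-integer norm multiplicativity; distinct by the 5-adic
  valuation of the first coordinate) — `modeSet_subset_shellSet`, `succ_le_card_modeSet`;
* the columnar datum `w_j = realTrigPoly (modeSet j) (fun _ => ê₂)` (modes `± gaussPoint j a`, all
  coefficients the vertical unit vector: a 2½-dimensional field `(0, 0, θ(x₀, x₁))`) is cross-transversal
  (`cross_modeSet`), so its heat flow is an exact global classical Navier–Stokes solution for every `ν`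
  (`TransversalModes.isClassicalNSSolutionOn_heatFlow_Ici`), and its Fourier coefficients are `ê₂` on
  `modeSet j`, `0` elsewhere (`coeffs_datum`);
* hence the alignment ratio over the FULL shell `shellSet (25^j) = {k ∈ ℤ³ : |k|² = 25^j}` equals the
  number of active modes `#(modeSet j) ≥ j + 1` (`alignRatio_shell_datum`, `succ_le_card_modeSet`), for
  every amplitude `ε > 0` (degree `0`);
* **`no_universal_shell_alignment_bound`**: for every `ν`, `C` and datum-dependent relaxation time `τ`,
  it is FALSE that `alignRatio (shellSet K) (û(t)) ≤ C` for all shells `K`, all `t ≥ τ(u(0))` and all global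
  classical solutions of the unforced Navier–Stokes system on `𝕋³` — the exact shape of the adjudicated
  display C135 `Literature.Claims.NS.Siche2026.Step4_print` / `Step2_dephasing` («sup_K χ_K(t) = O(1)
  … regardless of the initial phase configuration», Thm 6.28 (51) p.22 / Prop 5.9 (31) p.10; kernel-false
  `…Theorems.Siche2026.not_Step4_print` p509345, `not_Step2_dephasing` p507325), for the claim-independent
  canonical functional; the amplitude `ε` is free, so a constant allowed to depend on any size of the datum
  that is small along `ε → 0` does not help (`alignRatio_shell_datum` holds for every `ε > 0`).

## References

* A. J. Majda, A. L. Bertozzi, *Vorticity and Incompressible Flow*, CUP 2002, §1.2. [`MajdaBertozzi2002`]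
* L. Grafakos, *Classical Fourier Analysis*, 3rd ed. 2014, §3.1.1. [`Grafakos2014`]
* G. H. Hardy, E. M. Wright, *An Introduction to the Theory of Numbers*, 6th ed. 2008, §16.9–§16.10
  (`r₂(n)`, sums of two squares; here only the explicit points `(3+4i)^a` are used). [`HardyWright2008`]

WHAT THIS IS NOT: not a claim about NS regularity or blow-up; not a claim about any author beyond the
typed locator.
-/

set_option linter.dupNamespace false

noncomputable section

open Set Function MeasureTheory UnitAddTorus
open scoped ContDiff RealInnerProductSpace InnerProductSpace ComplexConjugate

namespace Literature.Barriers.NavierStokesRegularity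

namespace FrozenShellShape

open Literature.Analysis.FunctionSpaces Literature.Analysis.FunctionSpaces.Torus
  Literature.Analysis.FluidPDE Literature.Analysis.FluidPDE.TransversalModes

/-- `ℤ³`. [folklore] -/
abbrev Z3 : Type := Fin 3 → ℤ
/-- `𝕋³`. [folklore] -/
abbrev T3 : Type := UnitAddTorus (Fin 3)
/-- `ℝ³`. [folklore] -/
abbrev E3 : Type := EuclideanSpace ℝ (Fin 3)
/-- `ℂ³`. [folklore] -/
abbrev C3 : Type := EuclideanSpace ℂ (Fin 3)

/-! ## §1 Gaussian-integer points: `j + 1` horizontal lattice points on the shell `25^j` -/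

/-- `(p_a, q_a)` with `p_a + i q_a = (3 + 4i)^a`. [cite: HardyWright2008, §16.9] -/
def gauss : ℕ → ℤ × ℤ
  | 0 => (1, 0)
  | a + 1 => (3 * (gauss a).1 - 4 * (gauss a).2, 4 * (gauss a).1 + 3 * (gauss a).2)

/-- `p_a² + q_a² = 25^a`. [folklore] -/
private theorem gauss_normSq (a : ℕ) : (gauss a).1 ^ 2 + (gauss a).2 ^ 2 = 25 ^ a := by
  induction a with
  | zero => simp [gauss]
  | succ a ih => simp only [gauss, pow_succ]; nlinarith [ih]

/-- `(p_a, q_a) ≡ (3, 4) (mod 5)` for `a ≥ 1`, so `p_a ≢ 0`. [folklore] -/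
private theorem gauss_mod_five (a : ℕ) : (gauss a).1 % 5 = 1 ∨ (gauss a).1 % 5 = 3 := by
  suffices h : ∀ a, 1 ≤ a → (gauss a).1 % 5 = 3 ∧ (gauss a).2 % 5 = 4 by
    rcases Nat.eq_zero_or_pos a with rfl | ha
    · left; simp [gauss]
    · right; exact (h a ha).1
  intro a ha
  induction a with
  | zero => omega
  | succ a ih =>
    rcases Nat.eq_zero_or_pos a with rfl | ha'
    · simp [gauss]
    · obtain ⟨h1, h2⟩ := ih ha'
      simp only [gauss]
      omega

/-- `5 ∤ p_a`. [folklore] -/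
private theorem five_not_dvd_gauss (a : ℕ) : ¬ (5 : ℤ) ∣ (gauss a).1 := by
  intro h
  rcases gauss_mod_five a with h' | h' <;> omega

/-- The `a`-th horizontal point of the shell `25^j`: `5^{j−a} (p_a, q_a, 0)`. [cite: HardyWright2008, §16.9] -/
def gaussPoint (j a : ℕ) : Z3 := ![5 ^ (j - a) * (gauss a).1, 5 ^ (j - a) * (gauss a).2, 0]

/-- Integer norm: `|gaussPoint j a|² = 25^j` (`a ≤ j`). [folklore] -/
private theorem sum_sq_gaussPoint {j a : ℕ} (ha : a ≤ j) : ∑ i, gaussPoint j a i ^ 2 = (25 : ℤ) ^ j := by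
  simp only [Fin.sum_univ_three, gaussPoint, Matrix.cons_val_zero, Matrix.cons_val_one, Matrix.cons_val]
  have h25 : (25 : ℤ) ^ j = 25 ^ (j - a) * 25 ^ a := by rw [← pow_add, Nat.sub_add_cancel ha]
  rw [h25, ← gauss_normSq a,
    show (25 : ℤ) ^ (j - a) = (5 ^ (j - a)) ^ 2 by rw [← pow_mul, mul_comm, pow_mul]; norm_num]
  ring

/-- The points are horizontal: third coordinate `0`. [folklore] -/
private theorem gaussPoint_two (j a : ℕ) : gaussPoint j a 2 = 0 := by
  simp [gaussPoint]

/-- The points `gaussPoint j a`, `a ≤ j`, are distinct (5-adic valuation of the first coordinate). [folklore] -/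
private theorem gaussPoint_injOn (j : ℕ) : Set.InjOn (gaussPoint j) (Finset.range (j + 1) : Set ℕ) := by
  intro a ha b hb hab
  simp only [Finset.coe_range, Set.mem_Iio] at ha hb
  have h0 : (5 : ℤ) ^ (j - a) * (gauss a).1 = 5 ^ (j - b) * (gauss b).1 := by
    have := congrFun hab 0; simpa [gaussPoint] using this
  by_contra hne
  rcases lt_or_gt_of_ne hne with hlt | hlt
  · have hsplit : (5 : ℤ) ^ (j - a) = 5 ^ (j - b) * 5 ^ (b - a) := by
      rw [← pow_add]; congr 1; omega
    rw [hsplit, mul_assoc] at h0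
    have h5 : (gauss b).1 = 5 ^ (b - a) * (gauss a).1 :=
      (mul_left_cancel₀ (pow_ne_zero _ (by norm_num)) h0).symm
    apply five_not_dvd_gauss b
    rw [h5, show b - a = (b - a - 1) + 1 by omega, pow_succ]
    exact Dvd.dvd.mul_right (dvd_mul_left _ _) _
  · have hsplit : (5 : ℤ) ^ (j - b) = 5 ^ (j - a) * 5 ^ (a - b) := by
      rw [← pow_add]; congr 1; omega
    rw [hsplit, mul_assoc] at h0
    have h5 : (gauss a).1 = 5 ^ (a - b) * (gauss b).1 :=
      mul_left_cancel₀ (pow_ne_zero _ (by norm_num)) h0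
    apply five_not_dvd_gauss a
    rw [h5, show a - b = (a - b - 1) + 1 by omega, pow_succ]
    exact Dvd.dvd.mul_right (dvd_mul_left _ _) _

/-! ## §2 The full lattice shell and the columnar mode set -/

/-- The lattice shell `S_K = {k ∈ ℤ³ : |k|² = K}` as a finite set (coordinates lie in `[−K, K]`).
[cite: Grafakos2014, §3.1.1] -/
def shellSet (K : ℕ) : Finset Z3 :=
  (Fintype.piFinset fun _ : Fin 3 => Finset.Icc (-(K : ℤ)) K).filter fun k => ∑ i, k i ^ 2 = (K : ℤ)

/-- On the shell, `freqNormSq k = K`. [cite: Grafakos2014, §3.1.1] -/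
theorem freqNormSq_of_mem_shellSet {K : ℕ} {k : Z3} (hk : k ∈ shellSet K) : freqNormSq k = K := by
  have h := (Finset.mem_filter.1 hk).2
  unfold freqNormSq
  exact_mod_cast h

/-- A lattice point with `Σ kᵢ² = K` lies in the shell (the box condition is automatic). [folklore] -/
private theorem mem_shellSet_of_sum_sq {K : ℕ} {k : Z3} (hk : ∑ i, k i ^ 2 = (K : ℤ)) : k ∈ shellSet K := by
  rw [shellSet, Finset.mem_filter, Fintype.mem_piFinset]
  refine ⟨fun i => Finset.mem_Icc.2 ?_, hk⟩
  have hi : k i ^ 2 ≤ (K : ℤ) := by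
    rw [← hk, Fin.sum_univ_three]
    fin_cases i <;> simp <;> nlinarith [sq_nonneg (k 0), sq_nonneg (k 1), sq_nonneg (k 2)]
  have hK : (0 : ℤ) ≤ K := Int.natCast_nonneg K
  constructor <;> nlinarith [sq_nonneg (k i - 1), sq_nonneg (k i + 1)]

/-- The columnar mode set of level `j`: the points `± gaussPoint j a`, `a ≤ j`. [cite: HardyWright2008, §16.9] -/
def modeSet (j : ℕ) : Finset Z3 :=
  (Finset.range (j + 1)).image (gaussPoint j) ∪ (Finset.range (j + 1)).image (fun a => -gaussPoint j a)

/-- Members of the mode set are `± gaussPoint j a` with `a ≤ j`. [folklore] -/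
private theorem mem_modeSet {j : ℕ} {k : Z3} (hk : k ∈ modeSet j) :
    ∃ a, a ≤ j ∧ (k = gaussPoint j a ∨ k = -gaussPoint j a) := by
  rcases Finset.mem_union.1 hk with h | h
  · obtain ⟨a, ha, rfl⟩ := Finset.mem_image.1 h
    exact ⟨a, by rw [Finset.mem_range] at ha; omega, Or.inl rfl⟩
  · obtain ⟨a, ha, rfl⟩ := Finset.mem_image.1 h
    exact ⟨a, by rw [Finset.mem_range] at ha; omega, Or.inr rfl⟩

/-- The mode set is symmetric: `k ∈ modeSet j ↔ −k ∈ modeSet j`. [folklore] -/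
private theorem neg_mem_modeSet {j : ℕ} {k : Z3} (hk : k ∈ modeSet j) : -k ∈ modeSet j := by
  rcases Finset.mem_union.1 hk with h | h
  · obtain ⟨a, ha, rfl⟩ := Finset.mem_image.1 h
    exact Finset.mem_union.2 (Or.inr (Finset.mem_image.2 ⟨a, ha, rfl⟩))
  · obtain ⟨a, ha, rfl⟩ := Finset.mem_image.1 h
    exact Finset.mem_union.2 (Or.inl (Finset.mem_image.2 ⟨a, ha, by rw [neg_neg]⟩))

/-- The mode set is horizontal: `k 2 = 0`. [folklore] -/
private theorem modeSet_two {j : ℕ} {k : Z3} (hk : k ∈ modeSet j) : k 2 = 0 := by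
  obtain ⟨a, -, h | h⟩ := mem_modeSet hk
  · rw [h, gaussPoint_two]
  · rw [h, Pi.neg_apply, gaussPoint_two, neg_zero]

/-- **The mode set lies on ONE shell: `modeSet j ⊆ shellSet (25^j)`.** [cite: Grafakos2014, §3.1.1] -/
theorem modeSet_subset_shellSet (j : ℕ) : modeSet j ⊆ shellSet (25 ^ j) := by
  intro k hk
  obtain ⟨a, ha, h | h⟩ := mem_modeSet hk
  · exact mem_shellSet_of_sum_sq (by rw [h, sum_sq_gaussPoint ha]; push_cast; ring)
  · refine mem_shellSet_of_sum_sq ?_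
    have : ∑ i, k i ^ 2 = ∑ i, gaussPoint j a i ^ 2 := Finset.sum_congr rfl fun i _ => by rw [h]; simp
    rw [this, sum_sq_gaussPoint ha]; push_cast; ring

/-- **At least `j + 1` modes**: `j + 1 ≤ #(modeSet j)` (unbounded in `j`; `r₂(25^j) ≥ j + 1` via the points
`(3 + 4i)^a 5^{j−a}`). [cite: HardyWright2008, §16.9 Thm 278] -/
theorem succ_le_card_modeSet (j : ℕ) : j + 1 ≤ (modeSet j).card := by
  classical
  calc j + 1 = (Finset.range (j + 1)).card := (Finset.card_range _).symm
    _ = ((Finset.range (j + 1)).image (gaussPoint j)).card :=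
        (Finset.card_image_of_injOn (gaussPoint_injOn j)).symm
    _ ≤ (modeSet j).card := Finset.card_le_card Finset.subset_union_left

/-! ## §3 The columnar datum, its exact Navier–Stokes evolution and its Fourier coefficients -/

/-- The vertical unit vector `ê₂`, complexified, scaled by the amplitude `ε`. [cite: MajdaBertozzi2002, §1.2] -/
def vert (ε : ℝ) : C3 := EuclideanSpace.complexify (ε • EuclideanSpace.single 2 (1 : ℝ))

/-- `‖vert ε‖ = |ε|`. [folklore] -/
private theorem norm_vert (ε : ℝ) : ‖vert ε‖ = |ε| := by
  rw [vert, EuclideanSpace.norm_complexify, norm_smul, Real.norm_eq_abs]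
  simp

/-- `vert ε` is a real vector: `conj (vert ε) = vert ε`. [folklore] -/
private theorem conjVec_vert (ε : ℝ) : EuclideanSpace.conjVec (vert ε) = vert ε :=
  EuclideanSpace.conjVec_complexify _

/-- Horizontal components of `vert ε` vanish. [folklore] -/
private theorem vert_apply_of_ne_two (ε : ℝ) {i : Fin 3} (hi : i ≠ 2) : vert ε i = 0 := by
  simp [vert, EuclideanSpace.complexify_apply, hi]

/-- The columnar datum of level `j` and amplitude `ε`: `w = Re Σ_{k ∈ modeSet j} e_k (ε ê₂)` — the field
`(0, 0, θ(x₀, x₁))`. [cite: MajdaBertozzi2002, §1.2] -/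
def datum (j : ℕ) (ε : ℝ) : T3 → E3 := realTrigPoly (modeSet j) fun _ => vert ε

/-- **Cross-transversality of the columnar datum** (horizontal wave vectors, vertical coefficients).
[cite: MajdaBertozzi2002, §1.2] -/
theorem cross_modeSet (j : ℕ) (ε : ℝ) :
    ∀ k ∈ modeSet j, ∀ l ∈ modeSet j, ∑ i, (l i : ℂ) * (fun _ : Z3 => vert ε) k i = 0 := by
  intro k _ l hl
  rw [Fin.sum_univ_three, vert_apply_of_ne_two ε (show (0 : Fin 3) ≠ 2 by decide),
    vert_apply_of_ne_two ε (show (1 : Fin 3) ≠ 2 by decide), modeSet_two hl]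
  push_cast
  ring

/-- **The heat flow of the columnar datum is a global classical Navier–Stokes solution for every `ν`**,
with datum `datum j ε`. [cite: MajdaBertozzi2002, §1.2] -/
theorem isClassicalNSSolutionOn_heatFlow_datum (ν : ℝ) (j : ℕ) (ε : ℝ) :
    Torus.IsClassicalNSSolutionOn (Ici 0) ν 0 (heatFlow ν (modeSet j) fun _ => vert ε) (fun _ _ => (0 : ℝ)) ∧
      heatFlow ν (modeSet j) (fun _ => vert ε) 0 = datum j ε :=
  ⟨isClassicalNSSolutionOn_heatFlow_Ici ν (cross_modeSet j ε), heatFlow_zero ν _ _⟩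

/-- **Fourier coefficients of the datum**: `ŵ(k) = ε ê₂` on `modeSet j`, `0` elsewhere (the mode set is
symmetric and the coefficient vector is real). [cite: Grafakos2014, §3.1.1] -/
theorem coeffs_datum (j : ℕ) (ε : ℝ) (k : Z3) :
    coeffs (datum j ε) k = if k ∈ modeSet j then vert ε else 0 := by
  unfold coeffs datum
  rw [mFourierCoeff_realTrigPoly_eq]
  by_cases hk : k ∈ modeSet j
  · have hnk : -k ∈ modeSet j := neg_mem_modeSet hk
    simp only [if_pos hk, if_pos hnk]
    rw [conjVec_vert, ← two_smul ℂ (vert ε), smul_smul]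
    norm_num
  · have hnk : -k ∉ modeSet j := fun h => hk (by simpa using neg_mem_modeSet h)
    simp only [if_neg hk, if_neg hnk]
    rw [EuclideanSpace.conjVec_zero, add_zero, smul_zero]

/-- **The alignment ratio of the datum over the full shell equals the number of active modes**:
`A_{S_{25^j}}(ŵ) = #(modeSet j)`, for every amplitude `ε ≠ 0`. [cite: Grafakos2014, §3.1.1] -/
theorem alignRatio_shell_datum (j : ℕ) {ε : ℝ} (hε : ε ≠ 0) :
    alignRatio (shellSet (25 ^ j)) (coeffs (datum j ε)) = (modeSet j).card := by
  unfold alignRatio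
  simp_rw [coeffs_datum]
  have hsub := modeSet_subset_shellSet j
  have h1 : ∑ k ∈ shellSet (25 ^ j), (if k ∈ modeSet j then vert ε else 0) = ((modeSet j).card : ℂ) • vert ε := by
    rw [Finset.sum_ite_mem, Finset.inter_eq_right.2 hsub, Finset.sum_const, Nat.cast_smul_eq_nsmul]
  have h2 : ∑ k ∈ shellSet (25 ^ j), ‖(if k ∈ modeSet j then vert ε else (0 : C3))‖ ^ 2 =
      ((modeSet j).card : ℝ) * ε ^ 2 := by
    have : ∀ k, ‖(if k ∈ modeSet j then vert ε else (0 : C3))‖ ^ 2 =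
        if k ∈ modeSet j then ε ^ 2 else 0 := by
      intro k; split_ifs
      · rw [norm_vert, sq_abs]
      · simp
    simp_rw [this]
    rw [Finset.sum_ite_mem, Finset.inter_eq_right.2 hsub, Finset.sum_const, nsmul_eq_mul]
  rw [h1, h2, norm_smul, Complex.norm_natCast, norm_vert, mul_pow, sq_abs]
  have hε2 : (0 : ℝ) < ε ^ 2 := by positivity
  have hcard : (0 : ℝ) < (modeSet j).card := by
    have := succ_le_card_modeSet j
    exact_mod_cast Nat.lt_of_lt_of_le (Nat.succ_pos j) this
  rw [div_eq_iff (mul_pos hcard hε2).ne']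
  ring

/-! ## §4 The concrete barrier: no universal in-shell alignment bound along all solutions -/

/-- **NO UNIVERSAL BOUND ON THE IN-SHELL ALIGNMENT RATIO.** For every viscosity `ν`, every constant `C`
and every datum-dependent relaxation time `τ`, it is false that the phase-alignment ratio of the Fourier
coefficients over every lattice shell `S_K` is `≤ C` at all times `t ≥ τ(u(0))` along every global classical
solution of the unforced Navier–Stokes system on `𝕋³`: the columnar heat-flow solutions of level `j` keep
`A_{S_{25^j}} = #(modeSet j) ≥ j + 1` for all time (`static_bound_of_relaxation_law` +
`alignRatio_shell_datum`). [cite: MajdaBertozzi2002, §1.2] -/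
theorem no_universal_shell_alignment_bound (ν C : ℝ) (τ : (T3 → E3) → ℝ) :
    ¬ ∀ (K : ℕ) (u : ℝ → T3 → E3) (p : ℝ → T3 → ℝ), Torus.IsClassicalNSSolutionOn (Ici 0) ν 0 u p →
      ∀ t : ℝ, τ (u 0) ≤ t → 0 ≤ t → alignRatio (shellSet K) (coeffs (u t)) ≤ C := by
  intro hlaw
  obtain ⟨j, hj⟩ := exists_nat_gt C
  have hstatic : alignRatio (shellSet (25 ^ j)) (coeffs (datum j 1)) ≤ C :=
    static_bound_of_relaxation_law (Ψ := fun w => alignRatio (shellSet (25 ^ j)) (coeffs w))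
      (Φ := alignRatio (shellSet (25 ^ j))) (K := ((25 ^ j : ℕ) : ℝ)) (fun _ => rfl)
      (alignRatio_dep fun k hk => freqNormSq_of_mem_shellSet hk)
      (fun r hr a => alignRatio_hom _ r hr a) (hlaw (25 ^ j)) (cross_modeSet j 1)
  rw [alignRatio_shell_datum j one_ne_zero] at hstatic
  have hcard : (j : ℝ) + 1 ≤ ((modeSet j).card : ℝ) := by exact_mod_cast succ_le_card_modeSet j
  linarith

/-- The same with the amplitude free: for EVERY `ε ≠ 0` the level-`j` columnar datum of amplitude `ε`
already violates any bound `C < j + 1` at the datum itself (so constants allowed to depend on a size of the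
datum that is small along `ε → 0` do not help). [cite: MajdaBertozzi2002, §1.2] -/
theorem alignRatio_shell_datum_gt {C : ℝ} {j : ℕ} (hj : C < j + 1) {ε : ℝ} (hε : ε ≠ 0) :
    C < alignRatio (shellSet (25 ^ j)) (coeffs (datum j ε)) := by
  rw [alignRatio_shell_datum j hε]
  have hcard : (j : ℝ) + 1 ≤ ((modeSet j).card : ℝ) := by exact_mod_cast succ_le_card_modeSet j
  linarith

end FrozenShellShape

end Literature.Barriers.NavierStokesRegularity

end

-- WHAT THIS IS NOT: not a claim about NS regularity or blow-up; not a claim about any author beyond the typed locator.
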